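import Summits.QuantumFields.YangMills.Theorems.BalabanUVNodesN15KingModelCoverTopPieceRate
import HarnessLib

/-!
# BalabanUVNodes ∕ N15 — THE KING-MODEL RUNG (PART Ͻ-p): NE2⁺'s SITE AND OPERATOR LAYERS AT LIVE FLAT BACKGROUNDS — the typed hypothesis shapes `T4EtaRate.NE2PlusSite` ((3.48) template)
# and `NE2PlusOperator` ((3.42) template) ARE INHABITED, HYPOTHESIS-FREE, by the real and imaginary parts of King's toron top-scale-piece step on the TORON-VOLUME family of PART Ͻ-k
# (backgrounds = every constant abelian link field, `avg = ω ↦ ω^L`), constants `(C·K_{d+1}(δ∕2) + 1, δ∕2, γ∕2)` of the g0 rung uniform in the volume, the level AND THE TORON — PART Ͻ-o by name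
# (Track A, DAG node N15 = NE2; FAN-OUT v1.1 §N15 s3 «KING-MODEL RUNG … NE2's analogue DECIDED in the model … + what the curved case adds»; count-neutral)

HONEST FRAMING.  Count-neutral (cell `pub-ymgap`, seat `pub-ymgap-dag-n15-e` g45; `--supports stmt-QuantumFields-27247 --as helper` = K3ᴬ, KEY MAP v3).  A MODEL INHABITATION (as
PART Ͻ-k for the unit layer): King's `A = 0`-model top-scale piece `G^η_{(K)}` ([King1986] (2.17) p.653, (4.44)–(4.45) p.675) at block base points, at a constant abelian link field, on
the g0 rung's King-volume carriers (`torusOpGeo`, odd `L ≥ 3`) with the toron backgrounds `toronBg`; kernels split into real and imaginary parts; the operator layer through the g0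
readout (`opEntries₂`: the four (3.42) entries of the unit-lattice operator).  NOT Bałaban's `G_k(U)` ∕ Thm 3.1 (3.42) ∕ Thm 3.2 (3.48) at curved non-abelian backgrounds
([Balaban1985BackgroundPropagators] untouched); NOT a node discharge (N15 of record untouched — discharged by n15-a); nothing continuum ∕ ℝ⁴ ∕ OS ∕ Clay.

PROVED HERE:
* §1 SITE LAYER: `toronTopSiteRe`∕`toronTopSiteIm` (defs), ★★★ **`etaRateIneqSite_toronTop`** (`∃ C δ > 0`: for EVERY index, EVERY toron `U`, every `d′, p`: `EtaRateIneqSite d′ p (…Re j) C δ (γ∕2) U`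
  and the same for `Im`), ★★★★ **`ne2PlusSite_toronTopRe`**∕**`_Im`** (`NE2PlusSite d′ p c35 (toronVolInstance d L) …` hypothesis-free), `ne2ZeroSite_toronTopRe`∕`_Im`;
* §2 OPERATOR LAYER: `opKernelFamilyTw` (def: the g0 readout `opEntries₂` with toron backgrounds), `opKernelFamilyTw_e`, ★★ `etaRateIneq342_of_kernelBoundTw` (the g0 readout
  `etaRateIneq342_of_kernelBound₂` at toron backgrounds), `toronTopOpRe`∕`toronTopOpIm` (defs), ★★★★ **`ne2PlusOperator_toronTopRe`**∕**`_Im`** (`NE2PlusOperator c35 (toronVolInstance d L) …`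
  hypothesis-free, `B₀ = 4(d+1)e^{δ}·C`), `ne2ZeroOperator_toronTopRe`∕`_Im`, ★★★ `ne2Plus_toronTop_package`.
PRIOR TREE ART (by name): Ͻ-o (`toronTopPieceStep`, `norm_toronTopPieceStep_le_all`), Ͻ-k (`toronBg`, `toronVolInstance`), the g0 rung ∕ readout (`KingVolIndex`, `kingVol`, `kingVol_neZero`,
`opEntries₂`, `opEntries₂_le`, `tdistT_eq_dist`), `T4EtaRate` (`EtaRateIneqSite`, `EtaRateIneq342`, `NE2PlusSite`, `NE2PlusOperator`, `NE2ZeroOperator`, `ne2Zero_of_ne2Plus`, `rateFactor`,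
`pref4_one`), `T4EtaRateSiteOfRatePair.NE2ZeroSite`, `T4EtaRateOperatorTorus` (`torusOpGeo`, `torusOpGeo_len`, `rateFactor_torusOpGeo`, `torusOpGeo_dist`, `abs_le_supNorm_op`, `B0op`,
`B0op_pos`), Mathlib (`Complex.abs_re_le_norm`, `Complex.abs_im_le_norm`).  Dedup (rg at filing): basename 0 files; needles `toronTopSiteRe|opKernelFamilyTw|ne2PlusSite_toronTop|
ne2PlusOperator_toronTop` 0 tree files.  presearch: n/a (typed inhabitation by composition).  Locators: [Balaban1985BackgroundPropagators] Thm 3.1 (3.42) p.397, Thm 3.2 (3.48) p.398,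
Thm 3.14 pp.426–427 (quantifier templates), (3.35)–(3.36) p.396; [King1986] Prop. 3.9 (3.73) p.665, p.675, (4.44)–(4.45) p.675.  0 `sorry`, 5 `def`.
-/

noncomputable section

open scoped BigOperators ComplexConjugate ComplexOrder
open Finset Matrix

namespace Summit.QuantumFields.YangMills.BalabanUVNodes.N15KingModelRung.Cover

open Literature.MathematicalPhysics.QuantumFieldTheory.Balaban1983to89
open Literature.MathematicalPhysics.QuantumFieldTheory.Balaban1983to89.T4EtaRate (PairedInstance EtaRateIneqSite EtaRateIneq342 NE2PlusSite NE2PlusOperator NE2ZeroOperator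
  ne2Zero_of_ne2Plus rateFactor)
open Literature.MathematicalPhysics.QuantumFieldTheory.Balaban1983to89.T4EtaRateSiteOfRatePair (NE2ZeroSite)
open Literature.MathematicalPhysics.QuantumFieldTheory.Balaban1983to89.T4EtaRateOperatorTorus (torusOpGeo torusOpGeo_len rateFactor_torusOpGeo torusOpGeo_dist abs_le_supNorm_op B0op
  B0op_pos pref4_one)
open Literature.MathematicalPhysics.QuantumFieldTheory.Balaban1983to89.B5Prop11Plancherel (Tor)
open Literature.MathematicalPhysics.QuantumFieldTheory.King1986.Torus (tdistT)
open Summit.QuantumFields.YangMills.BalabanUVNodes.N15KingModelRung (KingVolIndex kingVol kingVol_neZero opEntries₂ opEntries₂_le tdistT_eq_dist)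

variable {d : ℕ} (L : ℕ) [NeZero L]

/-! ## §1 The site layer at the torons -/

/-- The REAL PART of the toron top-piece step as the typed site kernel on the toron-volume family. [cite: Balaban1985BackgroundPropagators, Thm 3.2 (3.48) p.398 (shape); King1986, (4.45) p.675] -/
def toronTopSiteRe (a m2 : ℝ) : ∀ j : KingVolIndex d, B9.SiteKernel (toronVolInstance d L j).gc (toronVolInstance d L j).Bf :=
  fun j => ⟨fun U b b' => (toronTopPieceStep L a m2 j U.1 b b').re⟩

/-- The IMAGINARY PART of the toron top-piece step as the typed site kernel. [cite: Balaban1985BackgroundPropagators, Thm 3.2 (3.48) p.398 (shape); King1986, (4.45) p.675] -/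
def toronTopSiteIm (a m2 : ℝ) : ∀ j : KingVolIndex d, B9.SiteKernel (toronVolInstance d L j).gc (toronVolInstance d L j).Bf :=
  fun j => ⟨fun U b b' => (toronTopPieceStep L a m2 j U.1 b b').im⟩

/-- ★★★ **THE TYPED SITE INEQUALITY AT EVERY TORON, UNIFORMLY** (odd `L ≥ 3`, `a, m² > 0`, `0 < γ ≤ 1`): ONE `(C, δ)` such that for EVERY index, EVERY toron `U` and every exponent pair
`(d′, p)`: `EtaRateIneqSite d′ p (toronTopSiteRe L a m² j) C δ (γ∕2) U` AND the same for the imaginary part. [cite: Balaban1985BackgroundPropagators, Thm 3.2 (3.48) p.398 (shape); King1986, Prop. 3.9 (3.73) p.665, p.675] -/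
theorem etaRateIneqSite_toronTop (hLodd : Odd L) (hL : 2 ≤ L) {a m2 : ℝ} (ha : 0 < a) (hm : 0 < m2) {γ : ℝ} (hγ0 : 0 < γ) (hγ1 : γ ≤ 1) :
    ∃ C δ : ℝ, 0 < C ∧ 0 < δ ∧ ∀ (j : KingVolIndex d) (U : (toronVolInstance d L j).Bf.Cfg) (d' : ℕ) (p : ℝ),
      EtaRateIneqSite d' p (toronTopSiteRe L a m2 j) C δ (γ / 2) U ∧ EtaRateIneqSite d' p (toronTopSiteIm L a m2 j) C δ (γ / 2) U := by
  obtain ⟨C, δ, hC, hδ, H⟩ := norm_toronTopPieceStep_le_all (d := d) L hLodd hL ha hm hγ0 hγ1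
  have hL0 : (0 : ℝ) < L := by exact_mod_cast Nat.pos_of_ne_zero (NeZero.ne L)
  refine ⟨C, δ, hC, hδ, fun j U d' p => ⟨fun y y' => ?_, fun y y' => ?_⟩⟩
  all_goals
    haveI := kingVol_neZero L j
    have hU := H j U.1 U.2 y y'
  · show |(toronTopPieceStep L a m2 j U.1 y y').re| ≤
      C * (torusOpGeo d (L : ℝ) j.Msz j.K (kingVol L j)).len y ^ (-p) *
      (torusOpGeo d (L : ℝ) j.Msz j.K (kingVol L j)).len y' ^ (-(d' : ℝ)) *
      Real.exp (-(δ * (torusOpGeo d (L : ℝ) j.Msz j.K (kingVol L j)).dist y y')) *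
      max (rateFactor (torusOpGeo d (L : ℝ) j.Msz j.K (kingVol L j)) (γ / 2) y) (rateFactor (torusOpGeo d (L : ℝ) j.Msz j.K (kingVol L j)) (γ / 2) y')
    rw [torusOpGeo_len _ hL0.ne', torusOpGeo_len _ hL0.ne', Real.one_rpow, Real.one_rpow, mul_one, mul_one, rateFactor_torusOpGeo _ hL0, rateFactor_torusOpGeo _ hL0, max_self,
      torusOpGeo_dist, ← tdistT_eq_dist]
    exact (Complex.abs_re_le_norm _).trans hU
  · show |(toronTopPieceStep L a m2 j U.1 y y').im| ≤
      C * (torusOpGeo d (L : ℝ) j.Msz j.K (kingVol L j)).len y ^ (-p) *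
      (torusOpGeo d (L : ℝ) j.Msz j.K (kingVol L j)).len y' ^ (-(d' : ℝ)) *
      Real.exp (-(δ * (torusOpGeo d (L : ℝ) j.Msz j.K (kingVol L j)).dist y y')) *
      max (rateFactor (torusOpGeo d (L : ℝ) j.Msz j.K (kingVol L j)) (γ / 2) y) (rateFactor (torusOpGeo d (L : ℝ) j.Msz j.K (kingVol L j)) (γ / 2) y')
    rw [torusOpGeo_len _ hL0.ne', torusOpGeo_len _ hL0.ne', Real.one_rpow, Real.one_rpow, mul_one, mul_one, rateFactor_torusOpGeo _ hL0, rateFactor_torusOpGeo _ hL0, max_self,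
      torusOpGeo_dist, ← tdistT_eq_dist]
    exact (Complex.abs_im_le_norm _).trans hU

/-- ★★★★ **`NE2PlusSite` IS INHABITED AT LIVE FLAT BACKGROUNDS — REAL PART** (odd `L ≥ 3`, `a, m² > 0`, `0 < γ ≤ 1`; every `d′`, `p`, `c35`): `(M₅, δ, a₀, C, γ′) = (1, δ, 1, C, γ∕2)`, uniform
in the volume, the level AND THE TORON. [cite: Balaban1985BackgroundPropagators, Thm 3.2 (3.48) p.398 + Thm 3.14 pp.426–427 (quantifier template); King1986, Prop. 3.9 (3.73) p.665, p.675] -/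
theorem ne2PlusSite_toronTopRe (hLodd : Odd L) (hL : 2 ≤ L) {a m2 : ℝ} (ha : 0 < a) (hm : 0 < m2) {γ : ℝ} (hγ0 : 0 < γ) (hγ1 : γ ≤ 1) (d' : ℕ) (p c35 : ℝ) :
    NE2PlusSite d' p c35 (toronVolInstance d L) (toronTopSiteRe L a m2) := by
  obtain ⟨C, δ, hC, hδ, H⟩ := etaRateIneqSite_toronTop (d := d) L hLodd hL ha hm hγ0 hγ1
  exact ⟨1, δ, 1, C, γ / 2, one_pos, hδ, one_pos, hC, half_pos hγ0, fun j _ _ _ _ U _ => (H j U d' p).1⟩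

/-- ★★★★ **`NE2PlusSite` IS INHABITED AT LIVE FLAT BACKGROUNDS — IMAGINARY PART.** [cite: Balaban1985BackgroundPropagators, Thm 3.2 (3.48) p.398 + Thm 3.14 pp.426–427 (quantifier template); King1986, Prop. 3.9 (3.73) p.665, p.675] -/
theorem ne2PlusSite_toronTopIm (hLodd : Odd L) (hL : 2 ≤ L) {a m2 : ℝ} (ha : 0 < a) (hm : 0 < m2) {γ : ℝ} (hγ0 : 0 < γ) (hγ1 : γ ≤ 1) (d' : ℕ) (p c35 : ℝ) :
    NE2PlusSite d' p c35 (toronVolInstance d L) (toronTopSiteIm L a m2) := by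
  obtain ⟨C, δ, hC, hδ, H⟩ := etaRateIneqSite_toronTop (d := d) L hLodd hL ha hm hγ0 hγ1
  exact ⟨1, δ, 1, C, γ / 2, one_pos, hδ, one_pos, hC, half_pos hγ0, fun j _ _ _ _ U _ => (H j U d' p).2⟩

/-- `NE2ZeroSite` for the real part (the `U ≡ 1` member). [cite: King1986, Prop. 3.9 (3.73) p.665, p.675 (A = 0 model)] -/
theorem ne2ZeroSite_toronTopRe (hLodd : Odd L) (hL : 2 ≤ L) {a m2 : ℝ} (ha : 0 < a) (hm : 0 < m2) {γ : ℝ} (hγ0 : 0 < γ) (hγ1 : γ ≤ 1) (d' : ℕ) (p : ℝ) :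
    NE2ZeroSite d' p (toronVolInstance d L) (toronTopSiteRe L a m2) := by
  obtain ⟨C, δ, hC, hδ, H⟩ := etaRateIneqSite_toronTop (d := d) L hLodd hL ha hm hγ0 hγ1
  exact ⟨1, δ, C, γ / 2, one_pos, hδ, hC, half_pos hγ0, fun j _ => (H j _ d' p).1⟩

/-- `NE2ZeroSite` for the imaginary part. [cite: King1986, Prop. 3.9 (3.73) p.665, p.675 (A = 0 model)] -/
theorem ne2ZeroSite_toronTopIm (hLodd : Odd L) (hL : 2 ≤ L) {a m2 : ℝ} (ha : 0 < a) (hm : 0 < m2) {γ : ℝ} (hγ0 : 0 < γ) (hγ1 : γ ≤ 1) (d' : ℕ) (p : ℝ) :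
    NE2ZeroSite d' p (toronVolInstance d L) (toronTopSiteIm L a m2) := by
  obtain ⟨C, δ, hC, hδ, H⟩ := etaRateIneqSite_toronTop (d := d) L hLodd hL ha hm hγ0 hγ1
  exact ⟨1, δ, C, γ / 2, one_pos, hδ, hC, half_pos hγ0, fun j _ => (H j _ d' p).2⟩

/-! ## §2 The operator layer at the torons -/

section Operator

variable {N : Fin (d + 1) → ℕ} [∀ μ, NeZero (N μ)]

/-- THE OPERATOR-LAYER KERNEL FAMILY OF A BACKGROUND-DEPENDENT TWO-POINT KERNEL on the operator carrier WITH TORON BACKGROUNDS: entries = the g0 readout `opEntries₂` (the four (3.42)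
entries of the unit-lattice operator); Hölder ∕ `L²` ∕ global entries inert (as in the lineage). [cite: Balaban1985BackgroundPropagators, (3.42) p.397 + Thm 3.14 pp.426–427 (typing template)] -/
def opKernelFamilyTw (K : (toronBg d).Cfg → Tor N → Tor N → ℝ) (Lr M : ℝ) (k : ℕ) : B9.KernelFamily (torusOpGeo d Lr M k N) (toronBg d) where
  e := fun n U lam y => opEntries₂ (K U) lam y n
  h1 := fun _ _ _ _ => 0
  e4 := fun _ _ _ => 0
  h2 := fun _ _ _ _ => 0
  l2 := fun _ _ _ _ => 0
  glob := fun _ _ _ _ => 0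

/-- Unfolding of the entries. [folklore] -/
@[simp] theorem opKernelFamilyTw_e (K : (toronBg d).Cfg → Tor N → Tor N → ℝ) (Lr M : ℝ) (k : ℕ) (n : Fin 4) (U : (toronBg d).Cfg) (lam : (torusOpGeo d Lr M k N).Loc) (y : Tor N) :
    (opKernelFamilyTw (N := N) K Lr M k).e n U lam y = opEntries₂ (K U) lam y n := rfl

/-- ★★ **THE g0 READOUT AT TORON BACKGROUNDS**: a kernel bound `|K_U(y,z)| ≤ A·e^{−δd(y,z)}·(L^{−γ})^k` at the background `U` gives `EtaRateIneq342 (opKernelFamilyTw K) (4(d+1)e^{δ}A) δ γ U`.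
[cite: Balaban1985BackgroundPropagators, (3.42) p.397 (shape); King1986, Prop. 3.9 (3.73) p.665] -/
theorem etaRateIneq342_of_kernelBoundTw {Lr : ℝ} (hL : 0 < Lr) (M : ℝ) (k : ℕ) {γ A δ : ℝ} {K : (toronBg d).Cfg → Tor N → Tor N → ℝ} (U : (toronBg d).Cfg)
    (hB : ∀ y z, |K U y z| ≤ A * Real.exp (-(δ * tdistT N y z)) * (Lr ^ (-γ)) ^ k) (hδ : 0 ≤ δ) :
    EtaRateIneq342 (opKernelFamilyTw (N := N) K Lr M k) (B0op d δ A) δ γ U := by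
  intro n lam y y' hs
  rw [opKernelFamilyTw_e, torusOpGeo_len N hL.ne', pref4_one, mul_one, rateFactor_torusOpGeo N hL, rateFactor_torusOpGeo N hL, max_self, torusOpGeo_dist, ← tdistT_eq_dist]
  exact opEntries₂_le hB hδ hs (abs_le_supNorm_op N Lr M k lam y') y n

end Operator

/-- The REAL-PART operator family of the toron top-piece step on the toron-volume family. [cite: Balaban1985BackgroundPropagators, (3.42) p.397 (shape); King1986, p.675 (object)] -/
def toronTopOpRe (a m2 : ℝ) : ∀ j : KingVolIndex d, B9.KernelFamily (toronVolInstance d L j).gc (toronVolInstance d L j).Bf :=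
  fun j =>
    haveI := kingVol_neZero L j
    opKernelFamilyTw (N := kingVol L j) (fun U b b' => (toronTopPieceStep L a m2 j U.1 b b').re) (L : ℝ) j.Msz j.K

/-- The IMAGINARY-PART operator family. [cite: Balaban1985BackgroundPropagators, (3.42) p.397 (shape); King1986, p.675 (object)] -/
def toronTopOpIm (a m2 : ℝ) : ∀ j : KingVolIndex d, B9.KernelFamily (toronVolInstance d L j).gc (toronVolInstance d L j).Bf :=
  fun j =>
    haveI := kingVol_neZero L j
    opKernelFamilyTw (N := kingVol L j) (fun U b b' => (toronTopPieceStep L a m2 j U.1 b b').im) (L : ℝ) j.Msz j.K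

/-- ★★★★ **`NE2PlusOperator` IS INHABITED AT LIVE FLAT BACKGROUNDS — REAL PART** (odd `L ≥ 3`, `a, m² > 0`, `0 < γ ≤ 1`; every `c35`): `(M₅, δ₀, a₀, B₀, γ′) = (1, δ, 1, 4(d+1)e^{δ}C, γ∕2)`
uniform in the volume, the level AND THE TORON. [cite: Balaban1985BackgroundPropagators, Thm 3.1 (3.42) p.397 + Thm 3.14 pp.426–427 (quantifier template); King1986, Prop. 3.9 (3.73) p.665, p.675] -/
theorem ne2PlusOperator_toronTopRe (hLodd : Odd L) (hL : 2 ≤ L) {a m2 : ℝ} (ha : 0 < a) (hm : 0 < m2) {γ : ℝ} (hγ0 : 0 < γ) (hγ1 : γ ≤ 1) (c35 : ℝ) :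
    NE2PlusOperator c35 (toronVolInstance d L) (toronTopOpRe L a m2) := by
  obtain ⟨C, δ, hC, hδ, H⟩ := norm_toronTopPieceStep_le_all (d := d) L hLodd hL ha hm hγ0 hγ1
  have hL0 : (0 : ℝ) < L := by exact_mod_cast Nat.pos_of_ne_zero (NeZero.ne L)
  refine ⟨1, δ, 1, B0op d δ C, γ / 2, one_pos, hδ, one_pos, B0op_pos d δ hC, half_pos hγ0, fun j _ _ _ _ U _ => ?_⟩
  haveI := kingVol_neZero L j
  exact etaRateIneq342_of_kernelBoundTw (N := kingVol L j) hL0 j.Msz j.K U (fun y z => (Complex.abs_re_le_norm _).trans (H j U.1 U.2 y z)) hδ.le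

/-- ★★★★ **`NE2PlusOperator` IS INHABITED AT LIVE FLAT BACKGROUNDS — IMAGINARY PART.** [cite: Balaban1985BackgroundPropagators, Thm 3.1 (3.42) p.397 + Thm 3.14 pp.426–427 (quantifier template); King1986, Prop. 3.9 (3.73) p.665, p.675] -/
theorem ne2PlusOperator_toronTopIm (hLodd : Odd L) (hL : 2 ≤ L) {a m2 : ℝ} (ha : 0 < a) (hm : 0 < m2) {γ : ℝ} (hγ0 : 0 < γ) (hγ1 : γ ≤ 1) (c35 : ℝ) :
    NE2PlusOperator c35 (toronVolInstance d L) (toronTopOpIm L a m2) := by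
  obtain ⟨C, δ, hC, hδ, H⟩ := norm_toronTopPieceStep_le_all (d := d) L hLodd hL ha hm hγ0 hγ1
  have hL0 : (0 : ℝ) < L := by exact_mod_cast Nat.pos_of_ne_zero (NeZero.ne L)
  refine ⟨1, δ, 1, B0op d δ C, γ / 2, one_pos, hδ, one_pos, B0op_pos d δ hC, half_pos hγ0, fun j _ _ _ _ U _ => ?_⟩
  haveI := kingVol_neZero L j
  exact etaRateIneq342_of_kernelBoundTw (N := kingVol L j) hL0 j.Msz j.K U (fun y z => (Complex.abs_im_le_norm _).trans (H j U.1 U.2 y z)) hδ.le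

/-- `NE2ZeroOperator` for the real part (the `U ≡ 1` member). [cite: King1986, Props. 3.8–3.9 (3.71)–(3.75) pp.664–665 (A = 0 model), p.675] -/
theorem ne2ZeroOperator_toronTopRe (hLodd : Odd L) (hL : 2 ≤ L) {a m2 : ℝ} (ha : 0 < a) (hm : 0 < m2) {γ : ℝ} (hγ0 : 0 < γ) (hγ1 : γ ≤ 1) :
    NE2ZeroOperator (toronVolInstance d L) (toronTopOpRe L a m2) :=
  ne2Zero_of_ne2Plus (c35 := 0) (fun _ _ _ => trivial) (ne2PlusOperator_toronTopRe L hLodd hL ha hm hγ0 hγ1 0)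

/-- `NE2ZeroOperator` for the imaginary part. [cite: King1986, Props. 3.8–3.9 (3.71)–(3.75) pp.664–665 (A = 0 model), p.675] -/
theorem ne2ZeroOperator_toronTopIm (hLodd : Odd L) (hL : 2 ≤ L) {a m2 : ℝ} (ha : 0 < a) (hm : 0 < m2) {γ : ℝ} (hγ0 : 0 < γ) (hγ1 : γ ≤ 1) :
    NE2ZeroOperator (toronVolInstance d L) (toronTopOpIm L a m2) :=
  ne2Zero_of_ne2Plus (c35 := 0) (fun _ _ _ => trivial) (ne2PlusOperator_toronTopIm L hLodd hL ha hm hγ0 hγ1 0)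

/-- ★★★ **PACKAGE — NE2⁺'s SITE AND OPERATOR LAYERS DECIDED IN KING's MODEL AT EVERY FLAT `U(1)` BACKGROUND** (with Ͻ-k's unit layer: all three typed layers of the node's NE2
shape are inhabited on the toron-volume family, hypothesis-free). [cite: Balaban1985BackgroundPropagators, Thm 3.1 (3.42) p.397, Thm 3.2 (3.48) p.398; King1986, Prop. 3.9 (3.73) p.665, p.675] -/
theorem ne2Plus_toronTop_package (hLodd : Odd L) (hL : 2 ≤ L) {a m2 : ℝ} (ha : 0 < a) (hm : 0 < m2) {γ : ℝ} (hγ0 : 0 < γ) (hγ1 : γ ≤ 1) (d' : ℕ) (p c35 : ℝ) :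
    NE2PlusSite d' p c35 (toronVolInstance d L) (toronTopSiteRe L a m2) ∧ NE2PlusSite d' p c35 (toronVolInstance d L) (toronTopSiteIm L a m2) ∧
    NE2PlusOperator c35 (toronVolInstance d L) (toronTopOpRe L a m2) ∧ NE2PlusOperator c35 (toronVolInstance d L) (toronTopOpIm L a m2) :=
  ⟨ne2PlusSite_toronTopRe L hLodd hL ha hm hγ0 hγ1 d' p c35, ne2PlusSite_toronTopIm L hLodd hL ha hm hγ0 hγ1 d' p c35,
   ne2PlusOperator_toronTopRe L hLodd hL ha hm hγ0 hγ1 c35, ne2PlusOperator_toronTopIm L hLodd hL ha hm hγ0 hγ1 c35⟩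

end Summit.QuantumFields.YangMills.BalabanUVNodes.N15KingModelRung.Cover

end
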